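import Summits.AnomalousDissipation.AnomalousDissipation.Theorems.BaireTransferDenseLoudDesignerForcesErgodicLine
import Literature.Analysis.FunctionSpaces.TorusClassicalNSBackwardUniqueness

/-!
# Backward uniqueness on an NS phase: every `φ_t` is injective on `K` (line `ergodic-budget-selection-closing`,
# crux `BaireTransfer.DenseLoudDesignerForces`, stmt-AnomalousDissipation-1143) — tools stub of block N

Sorry-free file over the landed vocabulary `…ErgodicLine.lean` (`Hsp`, `rep`, `IsNSPhase`) and the landed backward
uniqueness of classical Navier–Stokes solutions on the flat torus
(`Literature/Analysis/FunctionSpaces/TorusClassicalNSBackwardUniqueness.lean`: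
`Torus.IsClassicalNSSolutionOn.velocity_eq_of_eq` — on a convex time set two classical solutions with the same viscosity
`ν > 0` and force which agree at one time agree at all times).  Block N of the line needs the model semiflow to be INJECTIVE
on its compact invariant set (field `injOn` of `Literature.Dynamics.Hyperbolic.IsHyperbolicSemiflowModel`); on the
Navier–Stokes side this is the injectivity of the solution maps `S(t)` (Constantin–Foias 1988, Prop. 13.1 (iv)), i.e.
backward uniqueness (Thm 12.2 there; Temam 1997 Ch. III §6).  For an NS phase `(K, φ)` (`IsNSPhase ν F K φ`, `ν > 0`):

* `stub_phaseInjOnTools_aux_slice_eq` — two smooth slices representing the same state of `H` are equal (continuous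
  representatives of one `L²` class on the torus, whose Haar measure charges open sets);
* `stub_phaseInjOnTools_aux_trajectory_eq` — classical trajectories of two states `x, y ∈ K` with `φ_t x = φ_t y` for some
  `t ≥ 0` agree at every time `s ≥ 0` (they agree at time `t`, then `….velocity_eq_of_eq` on `Ici 0`);
* `stub_phaseInjOnTools` (the REGISTERED tools stub, proved) — `φ_t` is injective on `K` for every `t ≥ 0` (the trajectories
  agree at time `0`, where they represent `x = φ_0 x` and `y = φ_0 y`).

References: P. Constantin, C. Foias, *Navier–Stokes Equations* (Univ. Chicago Press 1988), Ch. 12 Thm 12.2 and Prop. 13.1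
(iv); R. Temam, *Infinite-Dimensional Dynamical Systems in Mechanics and Physics* (2nd ed., Springer 1997), Ch. III §6.
Nothing is asserted; no definition is added.
-/

-- `Summit.<Summit>.<Problem>` is the tree's mandated summit-side namespace (CONVENTIONS §2); for this
-- single-conjunct summit the two coincide, so the duplicate is deliberate.
set_option linter.dupNamespace false

noncomputable section

open scoped BigOperators Topology ENNReal InnerProductSpace
open Filter Set Function MeasureTheory

namespace Summit.AnomalousDissipation.AnomalousDissipation.Theorems.DenseLoudDesignerForces.Ergodic

open Literature.Analysis.FunctionSpaces Literature.Analysis.FunctionSpaces.Torus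
open Literature.Analysis.FluidPDE Literature.Analysis.FluidPDE.Torus

section PhaseInjOn

variable {ν : ℝ} {F : (UnitAddTorus (Fin 3)) → (EuclideanSpace ℝ (Fin 3))} {K : Set Hsp} {φ : ℝ → Hsp → Hsp}

/-! ## §1 Slices representing the same state -/

/-- Two slices (at times of `[0,∞)`) of classical solutions on `[0,∞) × T³` which represent the SAME state of `H` are
equal: both are smooth, hence continuous, and a.e. equal (to `rep z`), and the Haar measure of `T³` charges open sets
(`Continuous.ae_eq_iff_eq`). [folklore] -/
theorem stub_phaseInjOnTools_aux_slice_eq {u₁ u₂ : ℝ → (UnitAddTorus (Fin 3)) → (EuclideanSpace ℝ (Fin 3))}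
    {p₁ p₂ : ℝ → (UnitAddTorus (Fin 3)) → ℝ} (h₁ : IsClassicalNSSolutionOn (Ici 0) ν (fun _ => F) u₁ p₁)
    (h₂ : IsClassicalNSSolutionOn (Ici 0) ν (fun _ => F) u₂ p₂) {z : Hsp} {t₁ t₂ : ℝ} (ht₁ : 0 ≤ t₁) (ht₂ : 0 ≤ t₂)
    (hz₁ : rep z =ᵐ[volume] u₁ t₁) (hz₂ : rep z =ᵐ[volume] u₂ t₂) : u₁ t₁ = u₂ t₂ :=
  (Continuous.ae_eq_iff_eq volume (h₁.smooth_velocity.isSmooth_slice (mem_Ici.2 ht₁)).continuous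
    (h₂.smooth_velocity.isSmooth_slice (mem_Ici.2 ht₂)).continuous).1 (hz₁.symm.trans hz₂)

/-! ## §2 Trajectories through a common state agree at all times -/

/-- **Backward (and forward) uniqueness along an NS phase.**  Let `x, y ∈ K` have classical trajectories `(u₁, p₁)`,
`(u₂, p₂)` (global classical NS_ν(F) solutions on `[0,∞)` with `u₁(s)` representing `φ_s x` and `u₂(s)` representing
`φ_s y`, as provided by `IsNSPhase.trajectory`), and suppose `φ_t x = φ_t y` for some `t ≥ 0`.  Then `u₁(s) = u₂(s)` for
every `s ≥ 0`: the slices at time `t` represent the same state, hence coincide (`…_aux_slice_eq`), and two classical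
solutions with the same viscosity `ν > 0` and force on the convex time set `Ici 0` agreeing at one time agree at all
times (`Torus.IsClassicalNSSolutionOn.velocity_eq_of_eq`: log-convexity backward, energy method forward).
[cite: ConstantinFoiasNSE1988, Ch. 12 Thm 12.2 and Prop. 13.1 (iv)] -/
theorem stub_phaseInjOnTools_aux_trajectory_eq (hν : 0 < ν)
    {u₁ u₂ : ℝ → (UnitAddTorus (Fin 3)) → (EuclideanSpace ℝ (Fin 3))} {p₁ p₂ : ℝ → (UnitAddTorus (Fin 3)) → ℝ}
    (h₁ : IsClassicalNSSolutionOn (Ici 0) ν (fun _ => F) u₁ p₁) (h₂ : IsClassicalNSSolutionOn (Ici 0) ν (fun _ => F) u₂ p₂)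
    {x y : Hsp} (hx : ∀ s : ℝ, 0 ≤ s → rep (φ s x) =ᵐ[volume] u₁ s) (hy : ∀ s : ℝ, 0 ≤ s → rep (φ s y) =ᵐ[volume] u₂ s)
    {t : ℝ} (ht : 0 ≤ t) (hxy : φ t x = φ t y) {s : ℝ} (hs : 0 ≤ s) : u₁ s = u₂ s := by
  have hyt : rep (φ t x) =ᵐ[volume] u₂ t := by
    rw [hxy]
    exact hy t ht
  exact h₁.velocity_eq_of_eq hν (convex_Ici 0) h₂ (mem_Ici.2 ht)
    (stub_phaseInjOnTools_aux_slice_eq h₁ h₂ ht ht (hx t ht) hyt) (mem_Ici.2 hs)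

/-! ## §3 The registered tools stub -/

/-- **Tools stub N0b of block N (line `ergodic-budget-selection-closing`) — backward uniqueness on an NS phase: every
`φ_t` is injective on `K`.**  Two states `x, y ∈ K` with the same image under `φ_t` (`t ≥ 0`) have classical trajectories
(global classical NS_ν(F) solutions, `IsNSPhase.trajectory`) that agree at time `t`, hence at time `0` by backward
uniqueness for classical Navier–Stokes solutions on the torus (log-convexity; tree `TorusClassicalNSBackwardUniqueness`),
hence `x = φ_0 x` and `y = φ_0 y` have a.e.-equal representatives and coincide in `H` — the injectivity of the solution
maps `S(t)`. [cite: ConstantinFoiasNSE1988, Ch. 12 Thm 12.2 and Prop. 13.1 (iv)] -/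
theorem stub_phaseInjOnTools {ν : ℝ} {F : (UnitAddTorus (Fin 3)) → (EuclideanSpace ℝ (Fin 3))} {K : Set Hsp}
    {φ : ℝ → Hsp → Hsp} (hν : 0 < ν) (hK : IsNSPhase ν F K φ) : ∀ t : ℝ, 0 ≤ t → InjOn (φ t) K := by
  intro t ht x hx y hy hxy
  obtain ⟨u₁, p₁, h₁, hr₁⟩ := hK.trajectory x hx
  obtain ⟨u₂, p₂, h₂, hr₂⟩ := hK.trajectory y hy
  have h0 : u₁ 0 = u₂ 0 := stub_phaseInjOnTools_aux_trajectory_eq hν h₁ h₂ hr₁ hr₂ ht hxy le_rfl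
  have hx0 : rep x =ᵐ[volume] u₁ 0 := by
    have h := hr₁ 0 le_rfl
    rwa [hK.map_zero x hx] at h
  have hy0 : rep y =ᵐ[volume] u₂ 0 := by
    have h := hr₂ 0 le_rfl
    rwa [hK.map_zero y hy] at h
  have hrep : rep x =ᵐ[volume] rep y := hx0.trans (h0 ▸ hy0.symm)
  exact Subtype.ext (Lp.ext hrep)

end PhaseInjOn

end Summit.AnomalousDissipation.AnomalousDissipation.Theorems.DenseLoudDesignerForces.Ergodic

end
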